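import Literature.Geometry.Lorentzian.KerrShellKillingEnergyEstimate
import HarnessLib

/-!
# Boundedness of the energy in the middle region from a trapped-frequency decomposition
# (Dafermos–Rodnianski–Shlapentokh-Rothman, §13.1.3–§13.1.4, Props. 13.1.1–13.1.2)

(family `gr`; namespaces `Literature.Geometry.Lorentzian.Kerr` and `Literature.Geometry.Lorentzian`;
written from the proving seat of the named fact
`DafermosRodnianskiShlapentokhRothman2016_energyBoundedness_horizonRegular`
(`KerrHorizonRegularWaveBoundedness.lean`); no named facts are introduced (D-0026).)

DRSR arXiv:1402.7034 = Ann. of Math. 183 (2016), §13.1, bound the energy of a solution `ψ` of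
`□_g ψ = 0` through `Σ_τ ∩ [A₀ + δ, A₁ − δ]` (the region containing the trapped set) as follows:
the cut-off `ψ̃ = χ_{[A₀,A₁]}ψ` is decomposed in phase space (Carter's separation) into finitely many
pieces `ψ̃_i` "each of which experience trapping near a specific value of `r`" (Def. 13.1.1–13.1.2:
`r_trap ∈ 𝒞_i = [3M − s⁻ + (i−1)ε, 3M − s⁻ + iε)`), `□_g ψ̃_i = F̃_i` with `F̃_i` supported in the
collars; each piece is "sufficiently integrable", so by "a standard pigeonhole argument"
(Prop. 13.1.1) its energy is small on a sequence of late leaves; and the energy identity of a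
`φ_τ`-invariant timelike vector field `V_i`, Killing on the shell `𝒞_i` (built from Lemma 4.7.1:
`T + (2Mar/(r² + a²)²)Φ` is timelike off `𝓗⁺`), between `Σ_τ` and such a late leaf bounds the
energy of `ψ̃_i` on `Σ_τ` by the space-time integral of its energy OFF the shell — which the
phase-space integrated local energy decay (notCrudeILED) controls — plus the source term
(Prop. 13.1.2).

This file proves the physical-space part of that argument, in the ingoing Kerr–Schild chart, for
the horizon-regular class of the named fact and an admissible foliation `Σ̃_τ = {t* = τ + F}`
(towards the FUTURE, so that no extension of the solution to the past is needed):

* Part 1 — the DRSR profile `ω(r) = 2Mar/(r² + a²)²` (`Kerr.drsrAngularVelocity`): smoothness,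
  the co-orientation inequality `|ω(r)|√(r² + a²) < 1` for `r ≥ r₊`
  (`Kerr.abs_drsrAngularVelocity_mul_sqrt_lt_one`: `4M²a²r² < (r² + a²)³`), the profiles
  `Kerr.frozenProfile` frozen to a constant on a radial shell (so that `T + ΩΦ` is Killing there:
  "it is easy to construct a `φ_τ`-invariant timelike vector field `V_i` … Killing in the region …"),
  and the stability of timelikeness and co-orientation under small perturbations of the profile
  (`Kerr.exists_helical_margin`, from Lemma 4.7.1 = `Kerr.bilin_drsrVector_neg`, compactness and
  stationarity);
* Part 2 — the pigeonhole in time (`Kerr.exists_gt_le_of_lintegral_Ioi_lt_top`, Prop. 13.1.1 in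
  qualitative form) and bookkeeping lemmas for functions supported in a radial slab;
* Part 3 — **`kerr_horizonRegular_middleBound_of_trappedDecomposition`**: for subextremal
  `(M, a)`, `r₀ ≤ r₊`, `r₊ < A₀`, radii `A₀', A₁'` and admissible `F` there is `ε₀ > 0` such that for
  every finite family of shells `[lo_i, hi_i] ⊆ [A₀, A₁]` of widths `≤ ε₀` and every `B < ∞` there
  is `C < ∞` with: whenever `ψ` and `C²` functions `w_i` supported in `{A₀ ≤ r ≤ A₁}` satisfy
  (P1) `∑_i w_i = ψ` on `{A₀' < r < A₁'}` in the future of `Σ̃_0`, (P3) `∫_0^∞ E[w_i](s) ds < ∞`,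
  (P4) `∫_0^∞ E[w_i](s; r ∉ (lo_i, hi_i)) ds ≤ B E(0)`, (P5) `∫_0^∞ ∫ (□_g w_i)² ≤ B E(0)`,
  (P6) `□_g w_i = 0` on `{lo_i < r < hi_i}`, then `E(τ; A₀' < r < A₁') ≤ C E(0)` for all `τ ≥ 0`
  (`E` the coordinate energies `graphSliceEnergyOn` of `KerrWaveEnergy.lean`). The energy estimate
  for each piece is `Kerr.shell_helicalEnergy_estimate` (`KerrShellKillingEnergyEstimate.lean`)
  for `V_i = T + Ω_i(r)Φ`.

The hypotheses (P1)–(P6) are exactly what §§5–12 of loc. cit. (Carter's separation with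
Plancherel, the frequency-localised multiplier estimates of §8, the continuity argument of §11
and the precise integrated decay statement Prop. 12.1) deliver; they are NOT proved in this
library. With them, hypothesis (iii) of
`kerr_horizonRegular_energyBoundedness_of_shellDecay_of_middleBound`
(`KerrHorizonRegularBoundednessAssembly.lean`) follows.

## References

* M. Dafermos, I. Rodnianski, Y. Shlapentokh-Rothman, *Decay for solutions of the wave equation on
  Kerr exterior spacetimes III: the full subextremal case `|a| < M`*, Ann. of Math. 183 (2016)
  787–913, arXiv:1402.7034: Lemma 4.7.1, §12 Prop. 12.1, §13.1 (Def. 13.1.1–13.1.2,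
  Props. 13.1.1–13.1.2) (key `DafermosRodnianskiShlapentokhrothman2014`).
* M. Dafermos, I. Rodnianski, *Lectures on black holes and linear waves*, arXiv:0811.0354, App. D
  (key `DafermosRodnianski2008`).
-/

noncomputable section

open Set Filter Metric MeasureTheory
open scoped Topology Manifold ContDiff ENNReal

namespace Literature.Geometry.Lorentzian

namespace Kerr

variable {M a : ℝ} {x : E4}

/-! ## Part 1. The DRSR profile `ω(r) = 2Mar/(r² + a²)²`: smoothness, co-orientation, margins, and
the profiles frozen on a radial shell -/

/-- The DRSR angular-velocity profile is smooth on `ℝ` (a rational function without real poles for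
`a ≠ 0`; identically `0` for `a = 0`). [cite: DafermosRodnianskiShlapentokhrothman2014, Lemma 4.7.1] -/
theorem contDiff_drsrAngularVelocity (M a : ℝ) {n : WithTop ℕ∞} :
    ContDiff ℝ n (drsrAngularVelocity M a) := by
  by_cases ha : a = 0
  · have h : drsrAngularVelocity M a = fun _ ↦ 0 := by
      funext r; simp [drsrAngularVelocity, ha]
    rw [h]; exact contDiff_const
  · have h : drsrAngularVelocity M a = fun r ↦ 2 * M * a * r / (r ^ 2 + a ^ 2) ^ 2 := rfl
    rw [h]
    refine ContDiff.div (contDiff_const.mul contDiff_id) ((contDiff_id.pow 2).add contDiff_const |>.pow 2)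
      fun r ↦ ?_
    have : 0 < a ^ 2 := by positivity
    positivity

/-- **Co-orientation of the DRSR vector field through admissible leaves**: for subextremal `(M, a)`
and `r ≥ r₊`, `|ω(r)| √(r² + a²) < 1` (equivalently `4M²a²r² < (r² + a²)³`, from
`r² + a² ≥ r₊² + a² = 2Mr₊` and `r₊ > M > |a|`). With `Kerr.one_sub_le_sum_mul_helicalVector` this
gives `n(T + ω(r)Φ) > 0` for every admissible conormal. [cite: DafermosRodnianskiShlapentokhrothman2014, Lemma 4.7.1] -/
theorem abs_drsrAngularVelocity_mul_sqrt_lt_one (hMa : IsSubextremal M a) {r : ℝ}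
    (hr : rPlus M a ≤ r) : |drsrAngularVelocity M a r| * √(r ^ 2 + a ^ 2) < 1 := by
  have hM : 0 < M := hMa.pos
  have hrp : 0 < rPlus M a := hMa.rPlus_pos
  have hr0 : 0 < r := hrp.trans_le hr
  have haM : |a| < M := hMa
  have hMr : M < rPlus M a := hMa.M_lt_rPlus
  set Q : ℝ := r ^ 2 + a ^ 2 with hQ
  have hQ0 : 0 < Q := by positivity
  set s : ℝ := √Q with hs
  have hs0 : 0 < s := Real.sqrt_pos.mpr hQ0
  have hss : s ^ 2 = Q := Real.sq_sqrt hQ0.le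
  -- `|ω| = 2M|a|r/Q²`
  have habs : |drsrAngularVelocity M a r| = 2 * M * |a| * r / Q ^ 2 := by
    rw [drsrAngularVelocity, abs_div, abs_of_pos (by positivity : (0 : ℝ) < (r ^ 2 + a ^ 2) ^ 2)]
    congr 1
    rw [abs_mul, abs_mul, abs_mul, abs_of_pos hr0, abs_of_pos hM, abs_of_pos (by norm_num : (0:ℝ) < 2)]
  -- the key inequality `4M²a²r² < Q³`
  have hrp2 : a ^ 2 < rPlus M a ^ 2 := by
    have h1 : |a| < rPlus M a := haM.trans hMr
    have h2 : 0 ≤ |a| := abs_nonneg a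
    nlinarith [sq_abs a]
  have hQge : 2 * M * rPlus M a ≤ Q := by
    rw [← rPlus_sq_add_sq haM.le, hQ]
    nlinarith
  have hkey : (2 * M * |a| * r) ^ 2 < (s ^ 3) ^ 2 := by
    have h3 : (s ^ 3) ^ 2 = Q ^ 3 := by rw [← hss]; ring
    rw [h3]
    have h4 : Q * (2 * M * rPlus M a) ^ 2 ≤ Q ^ 3 := by
      have := mul_le_mul_of_nonneg_left (mul_self_le_mul_self (by positivity) hQge) hQ0.le
      nlinarith
    have h5 : (2 * M * |a| * r) ^ 2 = 4 * M ^ 2 * a ^ 2 * r ^ 2 := by rw [← sq_abs a]; ring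
    rw [h5]
    have h6 : 4 * M ^ 2 * a ^ 2 * r ^ 2 < 4 * M ^ 2 * rPlus M a ^ 2 * r ^ 2 := by
      have : 0 < 4 * M ^ 2 * r ^ 2 := by positivity
      nlinarith
    have h7 : 4 * M ^ 2 * rPlus M a ^ 2 * r ^ 2 ≤ Q * (2 * M * rPlus M a) ^ 2 := by
      have : r ^ 2 ≤ Q := by rw [hQ]; nlinarith
      nlinarith [sq_nonneg (M * rPlus M a)]
    linarith
  have hlt : 2 * M * |a| * r < s ^ 3 := lt_of_pow_lt_pow_left₀ 2 (by positivity) hkey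
  rw [habs]
  have hQ2 : Q ^ 2 = s * s ^ 3 := by rw [← hss]; ring
  rw [div_mul_eq_mul_div, div_lt_one (by positivity), hQ2]
  calc 2 * M * |a| * r * s = s * (2 * M * |a| * r) := by ring
    _ < s * s ^ 3 := mul_lt_mul_of_pos_left hlt hs0

/-- **A smooth shell bump**: `β(r) = σ((r − lo + 2δ)/δ) σ((hi + 2δ − r)/δ)` (`σ = Real.smoothTransition`)
equals `1` on `[lo − δ, hi + δ]`, vanishes off `(lo − 2δ, hi + 2δ)`, and takes values in `[0, 1]`.
[folklore] -/
def shellBump (lo hi δ r : ℝ) : ℝ :=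
  Real.smoothTransition ((r - (lo - 2 * δ)) / δ) * Real.smoothTransition ((hi + 2 * δ - r) / δ)

/-- The shell bump is smooth for `δ > 0`. [folklore] -/
theorem contDiff_shellBump (lo hi δ : ℝ) {n : ℕ∞} :
    ContDiff ℝ n (shellBump lo hi δ) := by
  have h1 : ContDiff ℝ n fun r : ℝ ↦ (r - (lo - 2 * δ)) / δ := (contDiff_id.sub contDiff_const).div_const δ
  have h2 : ContDiff ℝ n fun r : ℝ ↦ (hi + 2 * δ - r) / δ := (contDiff_const.sub contDiff_id).div_const δ
  have h3 := Real.smoothTransition.contDiff.comp h1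
  have h4 := Real.smoothTransition.contDiff.comp h2
  exact h3.mul h4

/-- `0 ≤ β ≤ 1`. [folklore] -/
theorem shellBump_mem_Icc (lo hi δ r : ℝ) : shellBump lo hi δ r ∈ Set.Icc (0 : ℝ) 1 :=
  ⟨mul_nonneg (Real.smoothTransition.nonneg _) (Real.smoothTransition.nonneg _),
    mul_le_one₀ (Real.smoothTransition.le_one _) (Real.smoothTransition.nonneg _)
      (Real.smoothTransition.le_one _)⟩

/-- `β = 1` on `[lo − δ, hi + δ]`. [folklore] -/
theorem shellBump_eq_one {lo hi δ r : ℝ} (hδ : 0 < δ) (h1 : lo - δ ≤ r) (h2 : r ≤ hi + δ) :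
    shellBump lo hi δ r = 1 := by
  unfold shellBump
  rw [Real.smoothTransition.one_of_one_le, Real.smoothTransition.one_of_one_le, one_mul]
  · rw [le_div_iff₀ hδ]; linarith
  · rw [le_div_iff₀ hδ]; linarith

/-- `β = 0` off `(lo − 2δ, hi + 2δ)`. [folklore] -/
theorem shellBump_eq_zero {lo hi δ r : ℝ} (hδ : 0 < δ) (h : r ≤ lo - 2 * δ ∨ hi + 2 * δ ≤ r) :
    shellBump lo hi δ r = 0 := by
  unfold shellBump
  rcases h with h | h
  · rw [Real.smoothTransition.zero_of_nonpos, zero_mul]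
    rw [div_nonpos_iff]; right; exact ⟨by linarith, hδ.le⟩
  · rw [Real.smoothTransition.zero_of_nonpos (x := (hi + 2 * δ - r) / δ), mul_zero]
    rw [div_nonpos_iff]; right; exact ⟨by linarith, hδ.le⟩

/-- **The profile frozen on a shell**: `Ω(r) = ω(r) + β(r)(ω(lo) − ω(r))` — equal to the constant
`ω(lo)` on `[lo − δ, hi + δ]` (so that `T + ΩΦ` is Killing there) and to the DRSR profile `ω` off
`(lo − 2δ, hi + 2δ)` ("it is easy to construct a `φ_τ`-invariant timelike vector field `V_i` on `𝓡`
which is Killing in the region `r ∈ [3M − s⁻ + (i−1)ε, 3M − s⁻ + iε)`", DRSR arXiv:1402.7034,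
proof of Prop. 13.1.2). [cite: DafermosRodnianskiShlapentokhrothman2014, §13.1.4] -/
def frozenProfile (M a lo hi δ : ℝ) (r : ℝ) : ℝ :=
  drsrAngularVelocity M a r +
    shellBump lo hi δ r * (drsrAngularVelocity M a lo - drsrAngularVelocity M a r)

/-- The frozen profile is smooth (`δ > 0`). [folklore] -/
theorem contDiff_frozenProfile (M a lo hi δ : ℝ) {n : ℕ∞} :
    ContDiff ℝ n (frozenProfile M a lo hi δ) :=
  (contDiff_drsrAngularVelocity M a).add ((contDiff_shellBump lo hi δ).mul
    (contDiff_const.sub (contDiff_drsrAngularVelocity M a)))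

/-- The frozen profile is constant `= ω(lo)` on `[lo − δ, hi + δ]`. [folklore] -/
theorem frozenProfile_eq_of_mem {M a lo hi δ r : ℝ} (hδ : 0 < δ) (h1 : lo - δ ≤ r)
    (h2 : r ≤ hi + δ) : frozenProfile M a lo hi δ r = drsrAngularVelocity M a lo := by
  rw [frozenProfile, shellBump_eq_one hδ h1 h2]; ring

/-- The frozen profile has zero derivative on `(lo − δ, hi + δ)`. [folklore] -/
theorem deriv_frozenProfile_eq_zero {M a lo hi δ r : ℝ} (hδ : 0 < δ) (h1 : lo - δ < r)
    (h2 : r < hi + δ) : deriv (frozenProfile M a lo hi δ) r = 0 := by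
  have hev : frozenProfile M a lo hi δ =ᶠ[𝓝 r] fun _ ↦ drsrAngularVelocity M a lo := by
    filter_upwards [Ioo_mem_nhds h1 h2] with r' hr'
    exact frozenProfile_eq_of_mem hδ hr'.1.le hr'.2.le
  rw [hev.deriv_eq]
  simp

/-- The frozen profile is uniformly close to the DRSR profile: if `|ω(lo) − ω(r)| ≤ μ` for all
`r ∈ [lo − 2δ, hi + 2δ]` (and `μ ≥ 0`), then `|Ω(r) − ω(r)| ≤ μ` for all `r`. [folklore] -/
theorem abs_frozenProfile_sub_le {M a lo hi δ μ : ℝ} (hδ : 0 < δ) (hμ : 0 ≤ μ)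
    (h : ∀ r, lo - 2 * δ ≤ r → r ≤ hi + 2 * δ →
      |drsrAngularVelocity M a lo - drsrAngularVelocity M a r| ≤ μ) (r : ℝ) :
    |frozenProfile M a lo hi δ r - drsrAngularVelocity M a r| ≤ μ := by
  rw [frozenProfile, add_sub_cancel_left, abs_mul]
  by_cases hr : lo - 2 * δ ≤ r ∧ r ≤ hi + 2 * δ
  · have hb := shellBump_mem_Icc lo hi δ r
    calc |shellBump lo hi δ r| * |drsrAngularVelocity M a lo - drsrAngularVelocity M a r|
        ≤ 1 * μ := mul_le_mul (by rw [abs_of_nonneg hb.1]; exact hb.2) (h r hr.1 hr.2)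
          (abs_nonneg _) zero_le_one
      _ = μ := one_mul μ
  · have h0 : shellBump lo hi δ r = 0 := by
      refine shellBump_eq_zero hδ ?_
      rcases not_and_or.mp hr with h' | h'
      · exact Or.inl (not_le.mp h').le
      · exact Or.inr (not_le.mp h').le
    rw [h0, abs_zero, zero_mul]
    exact hμ

/-- The derivative of the frozen profile is bounded on any compact interval. [folklore] -/
theorem exists_abs_deriv_frozenProfile_le (M a lo hi δ : ℝ) (A₀ A₁ : ℝ) :
    ∃ L : ℝ, 0 ≤ L ∧ ∀ r ∈ Set.Icc A₀ A₁, |deriv (frozenProfile M a lo hi δ) r| ≤ L := by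
  have hc : Continuous (deriv (frozenProfile M a lo hi δ)) :=
    (contDiff_frozenProfile M a lo hi δ (n := 1)).continuous_deriv le_rfl
  obtain ⟨L, hL⟩ := isCompact_Icc.exists_bound_of_continuousOn (hc.continuousOn (s := Set.Icc A₀ A₁))
  exact ⟨max L 0, le_max_right _ _, fun r hr ↦ (hL r hr).trans (le_max_left _ _)⟩

/-- **Timelikeness and co-orientation are stable**: for subextremal `(M, a)` and `r₊ < A₀` there is
`μ > 0` such that every profile `Ω` with `|Ω − ω| ≤ μ` (`ω` the DRSR profile) gives a vector field
`T + Ω(r)Φ` which is timelike on the slab `{A₀ ≤ r ≤ A₁}` (Lemma 4.7.1, `Kerr.bilin_drsrVector_neg`,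
plus compactness and stationarity) and satisfies `|Ω(r)|√(r² + a²) < 1` for `A₀ ≤ r ≤ A₁`
(`abs_drsrAngularVelocity_mul_sqrt_lt_one`). [cite: DafermosRodnianskiShlapentokhrothman2014, §13.1.4] -/
theorem exists_helical_margin (hMa : IsSubextremal M a) {A₀ A₁ : ℝ} (hA₀ : rPlus M a < A₀) :
    ∃ μ : ℝ, 0 < μ ∧ ∀ Ω : ℝ → ℝ, (∀ r, |Ω r - drsrAngularVelocity M a r| ≤ μ) →
      (∀ x : E4, A₀ ≤ radius a x → radius a x ≤ A₁ →
        bilin M a x (helicalVec a Ω x) (helicalVec a Ω x) < 0) ∧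
      (∀ r : ℝ, A₀ ≤ r → r ≤ A₁ → |Ω r| * √(r ^ 2 + a ^ 2) < 1) := by
  have hrp : 0 < rPlus M a := hMa.rPlus_pos
  have hA₀pos : 0 < A₀ := hrp.trans hA₀
  -- ### the timelikeness margin on the slab
  set f : E4 → ℝ := fun x ↦ bilin M a x (drsrVector M a x) (drsrVector M a x) with hf
  set g₁ : E4 → ℝ := fun x ↦ bilin M a x (drsrVector M a x) (axialVector x) with hg₁
  set g₂ : E4 → ℝ := fun x ↦ bilin M a x (axialVector x) (axialVector x) with hg₂
  have hax : Continuous (axialVector : E4 → E4) := by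
    have : (axialVector : E4 → E4) = fun y ↦ E4.axialGenerator y :=
      funext fun y ↦ by rw [E4.axialGenerator_apply]; rfl
    rw [this]
    exact E4.axialGenerator.continuous
  have hV : ContinuousOn (drsrVector M a) {x : E4 | 0 < radius a x} := by
    have h := continuousOn_helicalVec a (contDiff_drsrAngularVelocity M a (n := 0)).continuous
    have hfun : helicalVec a (drsrAngularVelocity M a) = drsrVector M a := funext fun x ↦ rfl
    rwa [hfun] at h
  have hbc : ∀ {u v : E4 → E4}, ContinuousOn u {x : E4 | 0 < radius a x} →
      ContinuousOn v {x : E4 | 0 < radius a x} →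
      ContinuousOn (fun x ↦ bilin M a x (u x) (v x)) {x : E4 | 0 < radius a x} := by
    intro u v hu hv x hx
    have hb : ContinuousAt (bilin M a) x := (contDiffAt_bilin M a hx (n := 0)).continuousAt
    exact (hb.continuousWithinAt.clm_apply (hu x hx)).clm_apply (hv x hx)
  have hfc : ContinuousOn f {x : E4 | 0 < radius a x} := hbc hV hV
  have hg₁c : ContinuousOn g₁ {x : E4 | 0 < radius a x} := hbc hV hax.continuousOn
  have hg₂c : ContinuousOn g₂ {x : E4 | 0 < radius a x} := hbc hax.continuousOn hax.continuousOn
  have hfinv : ∀ (x : E4) (t : ℝ), f (x + t • E4.basisVector 0) = f x := fun x t ↦ by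
    simp only [hf, bilin_add_smul_basisVector_zero, ← helicalVec_drsrAngularVelocity,
      helicalVec_add_smul_basisVector_zero]
  have haxinv : ∀ (x : E4) (t : ℝ), axialVector (x + t • E4.basisVector 0) = axialVector x := by
    intro x t
    ext α
    have h := axialComponents_add_smul_basisVector_zero x t α
    rwa [axialComponents_eq_axialVector, axialComponents_eq_axialVector] at h
  have hg₁inv : ∀ (x : E4) (t : ℝ), g₁ (x + t • E4.basisVector 0) = g₁ x := fun x t ↦ by
    simp only [hg₁, bilin_add_smul_basisVector_zero, ← helicalVec_drsrAngularVelocity,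
      helicalVec_add_smul_basisVector_zero, haxinv]
  have hg₂inv : ∀ (x : E4) (t : ℝ), g₂ (x + t • E4.basisVector 0) = g₂ x := fun x t ↦ by
    simp only [hg₂, bilin_add_smul_basisVector_zero, haxinv]
  obtain ⟨B₁, hB₁⟩ := exists_forall_abs_le_of_continuousOn_slab a hA₀pos g₁ hg₁c hg₁inv (R := A₁)
  obtain ⟨B₂, hB₂⟩ := exists_forall_abs_le_of_continuousOn_slab a hA₀pos g₂ hg₂c hg₂inv (R := A₁)
  -- a negative upper bound for `f` on the slab
  have hm : ∃ m₀ : ℝ, m₀ < 0 ∧ ∀ x : E4, A₀ ≤ radius a x → radius a x ≤ A₁ → f x ≤ m₀ := by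
    set K₀ : Set E4 := {x | x 0 = 0 ∧ |radius a x - (A₀ + A₁) / 2| ≤ (A₁ - A₀) / 2} with hK₀
    have hK₀c : IsCompact K₀ := isCompact_timeZero_radius_slab a (by linarith)
    have hK₀r : ∀ x ∈ K₀, A₀ ≤ radius a x ∧ radius a x ≤ A₁ := fun x hx ↦ by
      have h := abs_le.mp hx.2
      constructor <;> linarith [h.1, h.2]
    rcases K₀.eq_empty_or_nonempty with hKe | hne
    · refine ⟨-1, by norm_num, fun x h1 h2 ↦ ?_⟩
      exfalso
      have hx₀ : x + (-(x 0)) • E4.basisVector 0 ∈ K₀ := by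
        refine ⟨by simp [E4.basisVector], ?_⟩
        rw [radius_add_time_smul_basisVector]
        exact abs_le.mpr ⟨by linarith, by linarith⟩
      rw [hKe] at hx₀
      exact hx₀
    · obtain ⟨z, hz, hmax⟩ := hK₀c.exists_isMaxOn hne
        (hfc.mono fun x hx ↦ hA₀pos.trans_le (hK₀r x hx).1)
      refine ⟨f z, bilin_drsrVector_neg hMa (hA₀.trans_le (hK₀r z hz).1), fun x h1 h2 ↦ ?_⟩
      have hx₀ : x + (-(x 0)) • E4.basisVector 0 ∈ K₀ := by
        refine ⟨by simp [E4.basisVector], ?_⟩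
        rw [radius_add_time_smul_basisVector]
        exact abs_le.mpr ⟨by linarith, by linarith⟩
      have h : f (x + (-(x 0)) • E4.basisVector 0) ≤ f z := hmax hx₀
      rw [hfinv] at h
      exact h
  obtain ⟨m₀, hm₀, hfm⟩ := hm
  -- ### the co-orientation margin
  have hκ : ∃ κ₀ : ℝ, κ₀ < 1 ∧ ∀ r, A₀ ≤ r → r ≤ A₁ →
      |drsrAngularVelocity M a r| * √(r ^ 2 + a ^ 2) ≤ κ₀ := by
    rcases lt_or_ge A₁ A₀ with hlt | hle
    · exact ⟨0, one_pos, fun r h1 h2 ↦ absurd (h1.trans h2) (not_le.mpr hlt)⟩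
    · have hcont : ContinuousOn (fun r ↦ |drsrAngularVelocity M a r| * √(r ^ 2 + a ^ 2))
          (Set.Icc A₀ A₁) :=
        ((contDiff_drsrAngularVelocity M a (n := 0)).continuous.abs.mul
          ((continuous_id.pow 2 |>.add continuous_const).sqrt)).continuousOn
      obtain ⟨r₀, hr₀, hmax⟩ := isCompact_Icc.exists_isMaxOn (Set.nonempty_Icc.mpr hle) hcont
      exact ⟨_, abs_drsrAngularVelocity_mul_sqrt_lt_one hMa (hA₀.le.trans hr₀.1),
        fun r h1 h2 ↦ hmax ⟨h1, h2⟩⟩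
  obtain ⟨κ₀, hκ₀, hκ⟩ := hκ
  -- ### the choice of `μ`
  have hB₁0 : 0 ≤ |B₁| := abs_nonneg _
  have hB₂0 : 0 ≤ |B₂| := abs_nonneg _
  set D : ℝ := 2 * |B₁| + |B₂| + 1 with hD
  have hD0 : 0 < D := by positivity
  set S : ℝ := √(A₁ ^ 2 + a ^ 2) + 1 with hS
  have hS0 : 0 < S := by positivity
  set μ : ℝ := min 1 (min (-m₀ / (2 * D)) ((1 - κ₀) / (2 * S))) with hμ
  have hμpos : 0 < μ := lt_min one_pos (lt_min (by
    apply div_pos <;> linarith) (by apply div_pos <;> linarith))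
  have hμ1 : μ ≤ 1 := min_le_left _ _
  have hμD : μ * D ≤ -m₀ / 2 := by
    have h1 : μ ≤ -m₀ / (2 * D) := (min_le_right _ _).trans (min_le_left _ _)
    calc μ * D ≤ -m₀ / (2 * D) * D := mul_le_mul_of_nonneg_right h1 hD0.le
      _ = -m₀ / 2 := by field_simp
  have hμS : μ * S ≤ (1 - κ₀) / 2 := by
    have h1 : μ ≤ (1 - κ₀) / (2 * S) := (min_le_right _ _).trans (min_le_right _ _)
    calc μ * S ≤ (1 - κ₀) / (2 * S) * S := mul_le_mul_of_nonneg_right h1 hS0.le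
      _ = (1 - κ₀) / 2 := by field_simp
  refine ⟨μ, hμpos, fun Ω hΩ ↦ ⟨fun x h1 h2 ↦ ?_, fun r h1 h2 ↦ ?_⟩⟩
  · -- timelikeness: expand `g(V + dΦ, V + dΦ)`
    set d : ℝ := Ω (radius a x) - drsrAngularVelocity M a (radius a x) with hd
    have hdμ : |d| ≤ μ := hΩ _
    have hXV : helicalVec a Ω x = drsrVector M a x + d • axialVector x := by
      simp only [helicalVec, drsrVector, hd]
      rw [sub_smul]
      abel
    have hexp : bilin M a x (helicalVec a Ω x) (helicalVec a Ω x) =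
        f x + 2 * d * g₁ x + d ^ 2 * g₂ x := by
      rw [hXV]
      simp only [map_add, map_smul, _root_.add_apply, _root_.smul_apply, smul_eq_mul, hf, hg₁, hg₂]
      rw [bilin_symm M a x (axialVector x) (drsrVector M a x)]
      ring
    rw [hexp]
    have h1' := hfm x h1 h2
    have h2' : |g₁ x| ≤ |B₁| := (hB₁ x h1 h2).trans (le_abs_self _)
    have h3' : |g₂ x| ≤ |B₂| := (hB₂ x h1 h2).trans (le_abs_self _)
    have hd1 : |d| ≤ 1 := hdμ.trans hμ1
    have e1 : 2 * d * g₁ x ≤ 2 * μ * |B₁| := by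
      have : |2 * d * g₁ x| ≤ 2 * μ * |B₁| := by
        rw [abs_mul, abs_mul, abs_of_pos (by norm_num : (0:ℝ) < 2)]
        exact mul_le_mul (mul_le_mul_of_nonneg_left hdμ (by norm_num)) h2' (abs_nonneg _)
          (by positivity)
      exact (le_abs_self _).trans this
    have e2 : d ^ 2 * g₂ x ≤ μ * |B₂| := by
      have : |d ^ 2 * g₂ x| ≤ μ * |B₂| := by
        rw [abs_mul, abs_pow]
        have hd2 : |d| ^ 2 ≤ μ := by nlinarith [abs_nonneg d]
        exact mul_le_mul hd2 h3' (abs_nonneg _) hμpos.le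
      exact (le_abs_self _).trans this
    have : 2 * μ * |B₁| + μ * |B₂| ≤ μ * D := by rw [hD]; nlinarith
    linarith
  · -- co-orientation
    have h3 : |Ω r| ≤ |drsrAngularVelocity M a r| + μ := by
      have := hΩ r
      have h4 := abs_sub_abs_le_abs_sub (Ω r) (drsrAngularVelocity M a r)
      linarith
    have hsq : √(r ^ 2 + a ^ 2) ≤ S := by
      have hr0 : 0 ≤ r := (hA₀pos.le.trans h1)
      have : √(r ^ 2 + a ^ 2) ≤ √(A₁ ^ 2 + a ^ 2) :=
        Real.sqrt_le_sqrt (by nlinarith)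
      rw [hS]; linarith
    have hs0 : 0 ≤ √(r ^ 2 + a ^ 2) := Real.sqrt_nonneg _
    calc |Ω r| * √(r ^ 2 + a ^ 2) ≤ (|drsrAngularVelocity M a r| + μ) * √(r ^ 2 + a ^ 2) :=
          mul_le_mul_of_nonneg_right h3 hs0
      _ = |drsrAngularVelocity M a r| * √(r ^ 2 + a ^ 2) + μ * √(r ^ 2 + a ^ 2) := by ring
      _ ≤ κ₀ + μ * S := add_le_add (hκ r h1 h2) (mul_le_mul_of_nonneg_left hsq hμpos.le)
      _ < 1 := by linarith


/-! ## Part 2. Pigeonhole in time; functions supported in a radial slab -/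

/-- **Pigeonhole in time** (the "standard pigeonhole argument" of DRSR arXiv:1402.7034,
Prop. 13.1.1, qualitative form): if `∫_{(0,∞)} Λ < ∞` in `[0, ∞]` then `Λ` takes values `≤ η`
at arbitrarily late times, for every `η > 0`. [cite: DafermosRodnianskiShlapentokhrothman2014, Prop. 13.1.1] -/
theorem exists_gt_le_of_lintegral_Ioi_lt_top {Λ : ℝ → ℝ≥0∞} (h : ∫⁻ s in Set.Ioi 0, Λ s < ⊤)
    {η : ℝ≥0∞} (hη : 0 < η) {T : ℝ} (hT : 0 ≤ T) : ∃ t : ℝ, T < t ∧ Λ t ≤ η := by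
  by_contra hne
  push Not at hne
  have hmono : ∫⁻ s in Set.Ioi T, η ≤ ∫⁻ s in Set.Ioi T, Λ s :=
    setLIntegral_mono' measurableSet_Ioi fun t ht ↦ (hne t ht).le
  have hconst : ∫⁻ _ in Set.Ioi T, η = ⊤ := by
    rw [setLIntegral_const, Real.volume_Ioi, ENNReal.mul_top hη.ne']
  have hsub : ∫⁻ s in Set.Ioi T, Λ s ≤ ∫⁻ s in Set.Ioi 0, Λ s :=
    lintegral_mono_set (Set.Ioi_subset_Ioi hT)
  rw [hconst] at hmono
  have htop : ∫⁻ s in Set.Ioi 0, Λ s = ⊤ := top_le_iff.mp (hmono.trans hsub)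
  rw [htop] at h
  exact lt_irrefl _ h


/-! ### Functions supported in a radial slab: vanishing of the gradient, compact support on leaves -/

/-- Off the slab a function supported in the slab has zero derivative. [folklore] -/
theorem fderiv_eq_zero_of_support_slab {w : E4 → ℝ} {A₀ A₁ : ℝ}
    (hsupp : ∀ x, w x ≠ 0 → A₀ ≤ radius a x ∧ radius a x ≤ A₁) {x : E4}
    (hx : ¬(A₀ ≤ radius a x ∧ radius a x ≤ A₁)) : fderiv ℝ w x = 0 := by
  have hKc : IsClosed {x : E4 | A₀ ≤ radius a x ∧ radius a x ≤ A₁} := by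
    rw [Set.setOf_and]
    exact (isClosed_le continuous_const (continuous_radius a)).inter
      (isClosed_le (continuous_radius a) continuous_const)
  refine fderiv_eq_zero_of_forall_mem_eq_zero hKc.isOpen_compl (fun y hy ↦ ?_) hx
  by_contra h
  exact hy (hsupp y h)

/-- Points of the slab `{A₀ ≤ r ≤ A₁}`, `A₀ > 0`, have `‖x⃗‖ ≤ √(A₁² + a²)`. [folklore] -/
theorem spatialNorm_le_sqrt_of_slab {A₀ A₁ : ℝ} (hA₀ : 0 < A₀) {x : E4}
    (hx : A₀ ≤ radius a x ∧ radius a x ≤ A₁) : E4.spatialNorm x ≤ √(A₁ ^ 2 + a ^ 2) := by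
  have hxpos : 0 < radius a x := hA₀.trans_le hx.1
  have h1 := spatialNorm_sq_le hxpos (a := a)
  have h2 : radius a x ^ 2 ≤ A₁ ^ 2 := pow_le_pow_left₀ hxpos.le hx.2 2
  have h3 : E4.spatialNorm x ^ 2 ≤ A₁ ^ 2 + a ^ 2 := by linarith
  calc E4.spatialNorm x = √(E4.spatialNorm x ^ 2) := (Real.sqrt_sq (E4.spatialNorm_nonneg x)).symm
    _ ≤ √(A₁ ^ 2 + a ^ 2) := Real.sqrt_le_sqrt h3

/-- The wave operator of a `C²` function supported in a slab `{A₀ ≤ r ≤ A₁}`, `A₀ > 0`, is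
continuous on `ℝ⁴` and vanishes off the slab. [folklore] -/
theorem continuous_waveOperator_of_support_slab (M : ℝ) {w : E4 → ℝ} (hw : ContDiff ℝ 2 w)
    {A₀ A₁ : ℝ} (hA₀ : 0 < A₀) (hsupp : ∀ x, w x ≠ 0 → A₀ ≤ radius a x ∧ radius a x ≤ A₁) :
    Continuous (KerrSchild.waveOperator (inverseMetric M a) w) ∧
      ∀ x, ¬(A₀ ≤ radius a x ∧ radius a x ≤ A₁) →
        KerrSchild.waveOperator (inverseMetric M a) w x = 0 := by
  set Ksh : Set E4 := {x | A₀ ≤ radius a x ∧ radius a x ≤ A₁} with hKsh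
  have hKc : IsClosed Ksh := by
    rw [hKsh, Set.setOf_and]
    exact (isClosed_le continuous_const (continuous_radius a)).inter
      (isClosed_le (continuous_radius a) continuous_const)
  have hKU : Ksh ⊆ {x : E4 | 0 < radius a x} := fun x hx ↦ hA₀.trans_le hx.1
  have hbox0 : ∀ x, x ∉ Ksh → KerrSchild.waveOperator (inverseMetric M a) w x = 0 := by
    intro x hx
    simp only [KerrSchild.waveOperator]
    refine Finset.sum_eq_zero fun μ _ ↦ ?_
    have hz : ∀ y ∈ Kshᶜ, (∑ ν, inverseMetric M a y μ ν * fderiv ℝ w y (E4.basisVector ν)) = 0 :=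
      fun y hy ↦ Finset.sum_eq_zero fun ν _ ↦ by
        rw [fderiv_eq_zero_of_support_slab hsupp hy, zero_apply, mul_zero]
    rw [fderiv_eq_zero_of_forall_mem_eq_zero hKc.isOpen_compl hz hx, zero_apply]
  exact ⟨continuous_of_continuousAt_of_eq_zero hKc hKU
    (fun x hx ↦ continuousAt_waveOperator M a hw.contDiffAt hx) hbox0, fun x hx ↦ hbox0 x hx⟩

/-- On a graph leaf, a continuous density of a function supported in a slab, composed with the
gradient, has compact support: if `g` vanishes off the slab then `y ↦ g(t + F(y), y)` vanishes for
`‖y‖ > √(A₁² + a²)`. [folklore] -/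
theorem eq_zero_of_norm_gt_of_slab {g : E4 → ℝ} {A₀ A₁ : ℝ} (hA₀ : 0 < A₀)
    (hg : ∀ x, ¬(A₀ ≤ radius a x ∧ radius a x ≤ A₁) → g x = 0) (F : E3 → ℝ) (t : ℝ) {y : E3}
    (hy : √(A₁ ^ 2 + a ^ 2) < ‖y‖) : g (E4.ofTimeSpace (t + F y) y) = 0 := by
  refine hg _ fun h ↦ ?_
  have h1 := spatialNorm_le_sqrt_of_slab hA₀ h
  rw [E4.spatialNorm_ofTimeSpace] at h1
  linarith

/-- A continuous function on `ℝ⁴` vanishing off a slab is integrable along every graph leaf of a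
continuous height. [folklore] -/
theorem integrable_leaf_of_slab {g : E4 → ℝ} (hgc : Continuous g) {A₀ A₁ : ℝ} (hA₀ : 0 < A₀)
    (hg : ∀ x, ¬(A₀ ≤ radius a x ∧ radius a x ≤ A₁) → g x = 0) {F : E3 → ℝ} (hF : Continuous F)
    (t : ℝ) : Integrable (fun y : E3 ↦ g (E4.ofTimeSpace (t + F y) y)) := by
  have hc : Continuous fun y : E3 ↦ g (E4.ofTimeSpace (t + F y) y) :=
    hgc.comp (E4.continuous_ofTimeSpace' (continuous_const.add hF) continuous_id)
  refine hc.integrable_of_hasCompactSupport ?_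
  refine HasCompactSupport.intro (isCompact_closedBall (0 : E3) √(A₁ ^ 2 + a ^ 2)) fun y hy ↦ ?_
  rw [mem_closedBall, dist_zero_right, not_le] at hy
  exact eq_zero_of_norm_gt_of_slab hA₀ hg F t hy

end Kerr

/-! ## Part 3. The middle-region bound from a trapped-frequency decomposition (DRSR §13.1.3–§13.1.4) -/

/-- **Boundedness of the energy in the middle region from a trapped-set decomposition**
(the physical-space half of Dafermos–Rodnianski–Shlapentokh-Rothman arXiv:1402.7034, §13.1.3–
§13.1.4, Props. 13.1.1–13.1.2, for the horizon-regular class and an admissible foliation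
`Σ̃_τ = {t* = τ + F}`). Fix subextremal `(M, a)`, `r₀ ≤ r₊`, radii `r₊ < A₀` and `A₀' < A₁'`, and
an admissible `F`. There is `ε₀ > 0` (the timelikeness margin of the vector fields `T + Ω(r)Φ`,
`exists_helical_margin`, against the uniform continuity of the DRSR profile `ω`) such that for every
finite family of radial shells `[lo_i, hi_i] ⊆ [A₀, A₁]` of widths `≤ ε₀` and every `B < ∞` there is
`C < ∞` with the following property. Let `ψ : Kerr.region a r₀ → ℝ` and let `w_i ∈ C²(ℝ⁴)` be
functions supported in `{A₀ ≤ r ≤ A₁}` ("`ψ̃_i`", loc. cit. Def. 13.1.2) with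
(P1) `∑_i w_i = ψ` at the exterior points with `A₀' < r < A₁'` in the future of `Σ̃_0`;
(P3) `∫_0^∞ ∫ ∑(∂w_i)²(s + F(y), y) dy ds < ∞` ("sufficiently integrable", Prop. 13.1.1);
(P4) `∫_0^∞ ∫_{r ∉ (lo_i, hi_i)} ∑(∂w_i)² ≤ B E(0)` (the phase-space ILED (notCrudeILED) off the
shell where `V_i` is Killing, with Plancherel);
(P5) `∫_0^∞ ∫ (□_g w_i)² ≤ B E(0)` and (P6) `□_g w_i = 0` on `{lo_i < r < hi_i}` (the sources
`F̃_i`, supported in the collars, loc. cit. (13.1.2));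
where `E(0)` is the coordinate energy of `ψ|_{r>r₊}` through `Σ̃_0`. THEN
`E(τ; {A₀' < r < A₁'}) ≤ C E(0)` for all `τ ≥ 0`. Proof (loc. cit.): for each `i`, the two-sided
energy estimate of `V_i = T + Ω_i(r)Φ`, `Ω_i` the DRSR profile frozen on `[lo_i, hi_i]`
(`Kerr.shell_helicalEnergy_estimate`), between `Σ̃_τ` and a late leaf `Σ̃_t` on which the energy of
`w_i` is small (pigeonhole, (P3)); its error is controlled by (P4)–(P6); then
`∑_μ(∂_μ ∑_i w_i)² ≤ m ∑_i ∑_μ (∂_μw_i)²`. The hypotheses (P1)–(P6) — Carter's separation, the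
frequency-localised multiplier estimates and the continuity argument of §§5–12 of loc. cit. — are
NOT proved in this library. [cite: DafermosRodnianskiShlapentokhrothman2014, Prop. 13.1.2] -/
theorem kerr_horizonRegular_middleBound_of_trappedDecomposition [Kerr.Facts] [Kerr.SliceFacts]
    {M a r₀ : ℝ} (hMa : Kerr.IsSubextremal M a) (hr : r₀ ≤ Kerr.rPlus M a) {A₀ A₁ A₀' A₁' : ℝ}
    (hA₀ : Kerr.rPlus M a < A₀) {F : E3 → ℝ} (hF : Kerr.IsAdmissibleHeight M F) :
    ∃ ε₀ : ℝ, 0 < ε₀ ∧ ∀ (m : ℕ) (lo hi : Fin m → ℝ),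
      (∀ i, A₀ ≤ lo i ∧ lo i ≤ hi i ∧ hi i ≤ A₁ ∧ hi i - lo i ≤ ε₀) →
      ∀ B : ℝ≥0∞, B < ⊤ → ∃ C : ℝ≥0∞, C < ⊤ ∧
      ∀ (ψ : Kerr.region a r₀ → ℝ) (w : Fin m → E4 → ℝ),
        (∀ i, ContDiff ℝ 2 (w i)) →
        (∀ i x, w i x ≠ 0 → A₀ ≤ Kerr.radius a x ∧ Kerr.radius a x ≤ A₁) →
        (∀ x : Kerr.exterior M a, A₀' < Kerr.radius a (x : E4) → Kerr.radius a (x : E4) < A₁' →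
          F (E4.spatial (x : E4)) < (x : E4) 0 →
          ∑ i, w i x = ψ ⟨(x : E4), Kerr.region_mono a hr x.2⟩) →
        (∀ i, ∫⁻ s in Set.Ioi 0, ∫⁻ y, ENNReal.ofReal
          (∑ μ, fderiv ℝ (w i) (E4.ofTimeSpace (s + F y) y) (E4.basisVector μ) ^ 2) < ⊤) →
        (∀ i, ∫⁻ s in Set.Ioi 0, ∫⁻ y,
          {y : E3 | Kerr.radius a (E4.ofTimeSpace (s + F y) y) ∉ Set.Ioo (lo i) (hi i)}.indicator
            (fun y ↦ ENNReal.ofReal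
              (∑ μ, fderiv ℝ (w i) (E4.ofTimeSpace (s + F y) y) (E4.basisVector μ) ^ 2)) y ≤
          B * graphSliceEnergy (Kerr.exterior M a)
            (fun y : Kerr.exterior M a ↦ ψ ⟨(y : E4), Kerr.region_mono a hr y.2⟩) F 0) →
        (∀ i, ∫⁻ s in Set.Ioi 0, ∫⁻ y, ENNReal.ofReal
          (KerrSchild.waveOperator (Kerr.inverseMetric M a) (w i) (E4.ofTimeSpace (s + F y) y) ^ 2) ≤
          B * graphSliceEnergy (Kerr.exterior M a)
            (fun y : Kerr.exterior M a ↦ ψ ⟨(y : E4), Kerr.region_mono a hr y.2⟩) F 0) →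
        (∀ i x, lo i < Kerr.radius a x → Kerr.radius a x < hi i →
          KerrSchild.waveOperator (Kerr.inverseMetric M a) (w i) x = 0) →
        ∀ τ : ℝ, 0 ≤ τ →
          graphSliceEnergyOn (Kerr.exterior M a)
              (fun y : Kerr.exterior M a ↦ ψ ⟨(y : E4), Kerr.region_mono a hr y.2⟩) F τ
              {y | A₀' < Kerr.radius a (E4.ofTimeSpace (τ + F y) y) ∧
                Kerr.radius a (E4.ofTimeSpace (τ + F y) y) < A₁'} ≤
            C * graphSliceEnergy (Kerr.exterior M a)
              (fun y : Kerr.exterior M a ↦ ψ ⟨(y : E4), Kerr.region_mono a hr y.2⟩) F 0 := by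
  -- ### constants independent of the shells
  have hrp : 0 < Kerr.rPlus M a := hMa.rPlus_pos
  have hA₀pos : 0 < A₀ := hrp.trans hA₀
  obtain ⟨c, hc, hc1, hslope⟩ := hF.exists_slope_le'
  have hF2 : ContDiff ℝ 2 F := hF.contDiff.of_le (WithTop.coe_le_coe.mpr le_top)
  have hFc : ∀ y, ∑ i, Kerr.partialE3 F y i ^ 2 ≤ (1 - c) ^ 2 := fun y ↦
    (Kerr.sum_sq_partialE3_le F y).trans (pow_le_pow_left₀ (norm_nonneg _) (hslope y) 2)
  obtain ⟨μ, hμ, hmargin⟩ := Kerr.exists_helical_margin hMa hA₀ (A₁ := A₁)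
  -- uniform continuity of the DRSR profile on `[A₀ − 1, A₁ + 1]`
  have huc : ∃ δu : ℝ, 0 < δu ∧ ∀ r r' : ℝ, r ∈ Set.Icc (A₀ - 1) (A₁ + 1) →
      r' ∈ Set.Icc (A₀ - 1) (A₁ + 1) → |r - r'| ≤ δu →
      |Kerr.drsrAngularVelocity M a r - Kerr.drsrAngularVelocity M a r'| ≤ μ := by
    have hu := isCompact_Icc.uniformContinuousOn_of_continuous
      ((Kerr.contDiff_drsrAngularVelocity M a (n := 0)).continuous.continuousOn
        (s := Set.Icc (A₀ - 1) (A₁ + 1)))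
    rw [Metric.uniformContinuousOn_iff] at hu
    obtain ⟨δ, hδ, hδu⟩ := hu μ hμ
    refine ⟨δ / 2, by positivity, fun r r' hr hr' hrr' ↦ ?_⟩
    have h := hδu r hr r' hr' (by rw [Real.dist_eq]; linarith)
    rw [Real.dist_eq] at h
    exact h.le
  obtain ⟨δu, hδu, huc⟩ := huc
  set ε₀ : ℝ := min (1 / 4) (δu / 4) with hε₀
  have hε₀pos : 0 < ε₀ := lt_min (by norm_num) (by positivity)
  have hε₀q : ε₀ ≤ 1 / 4 := min_le_left _ _
  have hε₀δ : ε₀ ≤ δu / 4 := min_le_right _ _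
  refine ⟨ε₀, hε₀pos, fun m lo hi hsh B hB ↦ ?_⟩
  -- ### the frozen profiles and the per-shell constants
  set Ω : Fin m → ℝ → ℝ := fun i ↦ Kerr.frozenProfile M a (lo i) (hi i) ε₀ with hΩ
  have hΩ1 : ∀ i, ContDiff ℝ 1 (Ω i) := fun i ↦ Kerr.contDiff_frozenProfile M a (lo i) (hi i) ε₀
  have hΩclose : ∀ i r, |Ω i r - Kerr.drsrAngularVelocity M a r| ≤ μ := by
    intro i r
    refine Kerr.abs_frozenProfile_sub_le hε₀pos hμ.le (fun r' h1 h2 ↦ ?_) r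
    obtain ⟨hlo, hlohi, hhi, hwid⟩ := hsh i
    refine huc (lo i) r' ⟨by linarith, by linarith⟩ ⟨by linarith, by linarith⟩ ?_
    rw [abs_le]; constructor <;> linarith
  have htl : ∀ i, ∀ x : E4, A₀ ≤ Kerr.radius a x → Kerr.radius a x ≤ A₁ →
      Kerr.bilin M a x (Kerr.helicalVec a (Ω i) x) (Kerr.helicalVec a (Ω i) x) < 0 :=
    fun i ↦ (hmargin (Ω i) (hΩclose i)).1
  have hco : ∀ i, ∀ r : ℝ, A₀ ≤ r → r ≤ A₁ → |Ω i r| * √(r ^ 2 + a ^ 2) < 1 :=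
    fun i ↦ (hmargin (Ω i) (hΩclose i)).2
  have hest : ∀ i, ∃ b C : ℝ, 0 < b ∧ 0 ≤ C ∧
      ∀ (F : E3 → ℝ), ContDiff ℝ 2 F → (∀ y, ∑ i, Kerr.partialE3 F y i ^ 2 ≤ (1 - c) ^ 2) →
      ∀ w : E4 → ℝ, ContDiff ℝ 2 w → (∀ x, w x ≠ 0 → A₀ ≤ Kerr.radius a x ∧ Kerr.radius a x ≤ A₁) →
      ∀ τ s : ℝ, 0 ≤ s →
        b * (∫ y, ∑ μ, fderiv ℝ w (E4.ofTimeSpace (τ + F y) y) (E4.basisVector μ) ^ 2) ≤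
            C * (∫ y, ∑ μ, fderiv ℝ w (E4.ofTimeSpace (τ + s + F y) y) (E4.basisVector μ) ^ 2) +
              C * ∫ u in Set.Ioc τ (τ + s), ∫ y,
                (|KerrSchild.waveOperator (Kerr.inverseMetric M a) w (E4.ofTimeSpace (u + F y) y)| *
                    ∑ μ, |fderiv ℝ w (E4.ofTimeSpace (u + F y) y) (E4.basisVector μ)| +
                  |deriv (Ω i) (Kerr.radius a (E4.ofTimeSpace (u + F y) y))| *
                    ∑ μ, fderiv ℝ w (E4.ofTimeSpace (u + F y) y) (E4.basisVector μ) ^ 2) := by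
    intro i
    obtain ⟨b, C, hb, hC, h⟩ := Kerr.shell_helicalEnergy_estimate hMa hA₀ (hΩ1 i) (htl i) (hco i)
      hc hc1 (A₁ := A₁)
    exact ⟨b, C, hb, hC, fun F hF hFc w hw hs τ s hs0 ↦ (h F hF hFc w hw hs τ s hs0).2⟩
  choose b Cc hb hCc hest using hest
  have hL : ∀ i, ∃ L : ℝ, 0 ≤ L ∧ ∀ r ∈ Set.Icc A₀ A₁, |deriv (Ω i) r| ≤ L := fun i ↦
    Kerr.exists_abs_deriv_frozenProfile_le M a (lo i) (hi i) ε₀ A₀ A₁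
  choose L hL0 hL using hL
  -- the constants in `[0, ∞]`
  set Kc : Fin m → ℝ≥0∞ := fun i ↦ ENNReal.ofReal (1 / 2) + ENNReal.ofReal (2 + L i) with hKc
  set K : Fin m → ℝ≥0∞ := fun i ↦ ENNReal.ofReal (Cc i) * Kc i / ENNReal.ofReal (b i) with hK
  have hKtop : ∀ i, K i < ⊤ := fun i ↦ by
    refine ENNReal.div_lt_top (ENNReal.mul_ne_top ENNReal.ofReal_ne_top ?_) ?_
    · exact (ENNReal.add_lt_top.mpr ⟨ENNReal.ofReal_lt_top, ENNReal.ofReal_lt_top⟩).ne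
    · exact (ENNReal.ofReal_pos.mpr (hb i)).ne'
  set Ctot : ℝ≥0∞ := (m : ℝ≥0∞) * (∑ i, K i) * B + 1 with hCtot
  have hCtot_lt : Ctot < ⊤ := by
    refine ENNReal.add_lt_top.mpr ⟨?_, ENNReal.one_lt_top⟩
    refine ENNReal.mul_lt_top (ENNReal.mul_lt_top (ENNReal.natCast_lt_top m) ?_) hB
    exact ENNReal.sum_lt_top.mpr fun i _ ↦ hKtop i
  refine ⟨Ctot, hCtot_lt, fun ψ w hw hsupp hP1 hP3 hP4 hP5 hP6 τ hτ ↦ ?_⟩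
  -- ### notation for the fixed decomposition
  set ψ' : Kerr.exterior M a → ℝ := fun y ↦ ψ ⟨(y : E4), Kerr.region_mono a hr y.2⟩ with hψ'
  set E0 : ℝ≥0∞ := graphSliceEnergy (Kerr.exterior M a) ψ' F 0 with hE0
  set p2 : Fin m → E4 → ℝ := fun i x ↦ ∑ μ, fderiv ℝ (w i) x (E4.basisVector μ) ^ 2 with hp2
  set T1 : Fin m → E4 → ℝ := fun i x ↦ ∑ μ, |fderiv ℝ (w i) x (E4.basisVector μ)| with hT1
  set box : Fin m → E4 → ℝ := fun i ↦ KerrSchild.waveOperator (Kerr.inverseMetric M a) (w i)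
    with hbox
  set g : Fin m → E4 → ℝ := fun i x ↦ |box i x| * T1 i x + |deriv (Ω i) (Kerr.radius a x)| * p2 i x
    with hg
  set Λ : Fin m → ℝ → ℝ≥0∞ := fun i t ↦ ∫⁻ y, ENNReal.ofReal (p2 i (E4.ofTimeSpace (t + F y) y))
    with hΛ
  have hp2nn : ∀ i x, 0 ≤ p2 i x := fun i x ↦ Finset.sum_nonneg fun μ _ ↦ sq_nonneg _
  have hT1nn : ∀ i x, 0 ≤ T1 i x := fun i x ↦ Finset.sum_nonneg fun μ _ ↦ abs_nonneg _
  have hgnn : ∀ i x, 0 ≤ g i x := fun i x ↦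
    add_nonneg (mul_nonneg (abs_nonneg _) (hT1nn i x)) (mul_nonneg (abs_nonneg _) (hp2nn i x))
  have hdw0 : ∀ i x, ¬(A₀ ≤ Kerr.radius a x ∧ Kerr.radius a x ≤ A₁) → fderiv ℝ (w i) x = 0 :=
    fun i x hx ↦ Kerr.fderiv_eq_zero_of_support_slab (hsupp i) hx
  have hp20 : ∀ i x, ¬(A₀ ≤ Kerr.radius a x ∧ Kerr.radius a x ≤ A₁) → p2 i x = 0 := fun i x hx ↦ by
    simp only [hp2, hdw0 i x hx, zero_apply, ne_eq, OfNat.ofNat_ne_zero, not_false_eq_true, zero_pow,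
      Finset.sum_const_zero]
  have hT10 : ∀ i x, ¬(A₀ ≤ Kerr.radius a x ∧ Kerr.radius a x ≤ A₁) → T1 i x = 0 := fun i x hx ↦ by
    simp only [hT1, hdw0 i x hx, zero_apply, abs_zero, Finset.sum_const_zero]
  have hboxc : ∀ i, Continuous (box i) := fun i ↦
    (Kerr.continuous_waveOperator_of_support_slab M (hw i) hA₀pos (hsupp i)).1
  have hbox0 : ∀ i x, ¬(A₀ ≤ Kerr.radius a x ∧ Kerr.radius a x ≤ A₁) → box i x = 0 := fun i ↦
    (Kerr.continuous_waveOperator_of_support_slab M (hw i) hA₀pos (hsupp i)).2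
  have hpdc : ∀ i κ, Continuous fun x ↦ fderiv ℝ (w i) x (E4.basisVector κ) := fun i κ ↦
    (KerrSchild.contDiff_fderiv_apply_basisVector (hw i) κ).continuous
  have hp2c : ∀ i, Continuous (p2 i) := fun i ↦ continuous_finsetSum _ fun μ _ ↦ (hpdc i μ).pow 2
  have hT1c : ∀ i, Continuous (T1 i) := fun i ↦ continuous_finsetSum _ fun μ _ ↦ (hpdc i μ).abs
  have hΩ'c : ∀ i, Continuous fun x : E4 ↦ deriv (Ω i) (Kerr.radius a x) := fun i ↦
    ((hΩ1 i).continuous_deriv le_rfl).comp (Kerr.continuous_radius a)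
  have hgc : ∀ i, Continuous (g i) := fun i ↦
    ((hboxc i).abs.mul (hT1c i)).add ((hΩ'c i).abs.mul (hp2c i))
  have hg0 : ∀ i x, ¬(A₀ ≤ Kerr.radius a x ∧ Kerr.radius a x ≤ A₁) → g i x = 0 := fun i x hx ↦ by
    simp only [hg, hbox0 i x hx, hT10 i x hx, hp20 i x hx, abs_zero, mul_zero, add_zero]
  have hgraph : ∀ t : ℝ, Continuous fun y : E3 ↦ E4.ofTimeSpace (t + F y) y := fun t ↦
    E4.continuous_ofTimeSpace' (continuous_const.add hF2.continuous) continuous_id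
  have hgraph2 : Continuous fun q : ℝ × E3 ↦ E4.ofTimeSpace (q.1 + F q.2) q.2 :=
    E4.continuous_ofTimeSpace' (continuous_fst.add (hF2.continuous.comp continuous_snd)) continuous_snd
  -- integrability on the leaves; `Λ` as `ofReal` of the real energy
  have hp2i : ∀ i t, Integrable (fun y : E3 ↦ p2 i (E4.ofTimeSpace (t + F y) y)) := fun i t ↦
    Kerr.integrable_leaf_of_slab (hp2c i) hA₀pos (hp20 i) hF2.continuous t
  have hΛeq : ∀ i t, ENNReal.ofReal (∫ y, p2 i (E4.ofTimeSpace (t + F y) y)) = Λ i t := fun i t ↦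
    ofReal_integral_eq_lintegral_ofReal (hp2i i t) (ae_of_all _ fun y ↦ hp2nn i _)
  -- ### the pointwise error inequality
  have hgpt : ∀ i (u : ℝ) (y : E3), ENNReal.ofReal (g i (E4.ofTimeSpace (u + F y) y)) ≤
      ENNReal.ofReal (1 / 2) * ENNReal.ofReal (box i (E4.ofTimeSpace (u + F y) y) ^ 2) +
        ENNReal.ofReal (2 + L i) *
          {y : E3 | Kerr.radius a (E4.ofTimeSpace (u + F y) y) ∉ Set.Ioo (lo i) (hi i)}.indicator
            (fun y ↦ ENNReal.ofReal (p2 i (E4.ofTimeSpace (u + F y) y))) y := by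
    intro i u y
    set z := E4.ofTimeSpace (u + F y) y with hz
    by_cases hin : lo i < Kerr.radius a z ∧ Kerr.radius a z < hi i
    · -- inside the shell: no bulk, no source
      have h1 : box i z = 0 := hP6 i z hin.1 hin.2
      have h2 : deriv (Ω i) (Kerr.radius a z) = 0 :=
        Kerr.deriv_frozenProfile_eq_zero hε₀pos (by linarith [hin.1]) (by linarith [hin.2])
      have h3 : g i z = 0 := by simp only [hg, h1, h2, abs_zero, zero_mul, add_zero]
      rw [h3, ENNReal.ofReal_zero]
      exact zero_le
    · have hmem : y ∈ {y : E3 | Kerr.radius a (E4.ofTimeSpace (u + F y) y) ∉ Set.Ioo (lo i) (hi i)} := by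
        simpa only [Set.mem_setOf_eq, Set.mem_Ioo] using hin
      rw [Set.indicator_of_mem hmem]
      by_cases hsl : A₀ ≤ Kerr.radius a z ∧ Kerr.radius a z ≤ A₁
      · have hL' : |deriv (Ω i) (Kerr.radius a z)| ≤ L i := hL i _ ⟨hsl.1, hsl.2⟩
        have hsq : T1 i z ^ 2 ≤ 4 * p2 i z := Kerr.sq_sum_abs_le_four_mul _
        have hreal : g i z ≤ 1 / 2 * box i z ^ 2 + (2 + L i) * p2 i z := by
          have hb2 : |box i z| * T1 i z ≤ 1 / 2 * box i z ^ 2 + 1 / 2 * T1 i z ^ 2 := by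
            nlinarith [sq_nonneg (|box i z| - T1 i z), sq_abs (box i z)]
          have hd : |deriv (Ω i) (Kerr.radius a z)| * p2 i z ≤ L i * p2 i z :=
            mul_le_mul_of_nonneg_right hL' (hp2nn i z)
          simp only [hg]
          nlinarith [hp2nn i z]
        calc ENNReal.ofReal (g i z) ≤ ENNReal.ofReal (1 / 2 * box i z ^ 2 + (2 + L i) * p2 i z) :=
              ENNReal.ofReal_le_ofReal hreal
          _ = ENNReal.ofReal (1 / 2) * ENNReal.ofReal (box i z ^ 2) +
                ENNReal.ofReal (2 + L i) * ENNReal.ofReal (p2 i z) := by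
              rw [ENNReal.ofReal_add (by positivity) (mul_nonneg (by linarith [hL0 i]) (hp2nn i z)),
                ENNReal.ofReal_mul (by norm_num), ENNReal.ofReal_mul (by linarith [hL0 i])]
      · rw [hg0 i z hsl, ENNReal.ofReal_zero]
        exact zero_le
  -- ### the integrated error bound
  have hmeas_box : ∀ i, Measurable fun u : ℝ ↦ ∫⁻ y, ENNReal.ofReal (1 / 2) *
      ENNReal.ofReal (box i (E4.ofTimeSpace (u + F y) y) ^ 2) := by
    intro i
    have hf : Measurable fun q : ℝ × E3 ↦ ENNReal.ofReal (1 / 2) *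
        ENNReal.ofReal (box i (E4.ofTimeSpace (q.1 + F q.2) q.2) ^ 2) :=
      ((((hboxc i).comp hgraph2).pow 2).measurable.ennreal_ofReal).const_mul _
    exact hf.lintegral_prod_right'
  have herrI : ∀ i (τ' t : ℝ), 0 ≤ τ' →
      ENNReal.ofReal (∫ u in Set.Ioc τ' t, ∫ y, g i (E4.ofTimeSpace (u + F y) y)) ≤ Kc i * B * E0 := by
    intro i τ' t hτ'
    -- `ofReal ∫ f ≤ ∫⁻ ofReal f` for nonnegative `f` (with or without integrability)
    have hoR : ∀ {α : Type} [MeasurableSpace α] (ν : Measure α) (f : α → ℝ), (∀ x, 0 ≤ f x) →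
        ENNReal.ofReal (∫ x, f x ∂ν) ≤ ∫⁻ x, ENNReal.ofReal (f x) ∂ν := by
      intro α _ ν f hf
      by_cases hfi : Integrable f ν
      · rw [ofReal_integral_eq_lintegral_ofReal hfi (ae_of_all _ hf)]
      · rw [integral_undef hfi, ENNReal.ofReal_zero]
        exact zero_le
    have h1 : ENNReal.ofReal (∫ u in Set.Ioc τ' t, ∫ y, g i (E4.ofTimeSpace (u + F y) y)) ≤
        ∫⁻ u in Set.Ioc τ' t, ENNReal.ofReal (∫ y, g i (E4.ofTimeSpace (u + F y) y)) :=
      hoR _ _ fun u ↦ integral_nonneg fun y ↦ hgnn i _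
    have h2 : ∫⁻ u in Set.Ioc τ' t, ENNReal.ofReal (∫ y, g i (E4.ofTimeSpace (u + F y) y)) ≤
        ∫⁻ u in Set.Ioc τ' t, ∫⁻ y, ENNReal.ofReal (g i (E4.ofTimeSpace (u + F y) y)) :=
      lintegral_mono fun u ↦ hoR _ _ fun y ↦ hgnn i _
    have h3 : ∫⁻ u in Set.Ioc τ' t, ∫⁻ y, ENNReal.ofReal (g i (E4.ofTimeSpace (u + F y) y)) ≤
        ∫⁻ u in Set.Ioi 0, ∫⁻ y, ENNReal.ofReal (g i (E4.ofTimeSpace (u + F y) y)) :=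
      lintegral_mono_set (Set.Ioc_subset_Ioi_self.trans (Set.Ioi_subset_Ioi hτ'))
    set I5 : ℝ≥0∞ := ∫⁻ u in Set.Ioi 0, ∫⁻ y,
      ENNReal.ofReal (box i (E4.ofTimeSpace (u + F y) y) ^ 2) with hI5
    set I4 : ℝ≥0∞ := ∫⁻ u in Set.Ioi 0, ∫⁻ y,
      {y : E3 | Kerr.radius a (E4.ofTimeSpace (u + F y) y) ∉ Set.Ioo (lo i) (hi i)}.indicator
        (fun y ↦ ENNReal.ofReal (p2 i (E4.ofTimeSpace (u + F y) y))) y with hI4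
    have h4 : ∫⁻ u in Set.Ioi 0, ∫⁻ y, ENNReal.ofReal (g i (E4.ofTimeSpace (u + F y) y)) ≤
        ∫⁻ u in Set.Ioi 0, ((∫⁻ y, ENNReal.ofReal (1 / 2) *
            ENNReal.ofReal (box i (E4.ofTimeSpace (u + F y) y) ^ 2)) +
          ∫⁻ y, ENNReal.ofReal (2 + L i) *
            {y : E3 | Kerr.radius a (E4.ofTimeSpace (u + F y) y) ∉ Set.Ioo (lo i) (hi i)}.indicator
              (fun y ↦ ENNReal.ofReal (p2 i (E4.ofTimeSpace (u + F y) y))) y) := by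
      refine lintegral_mono fun u ↦ ?_
      have hm : Measurable fun y : E3 ↦ ENNReal.ofReal (1 / 2) *
          ENNReal.ofReal (box i (E4.ofTimeSpace (u + F y) y) ^ 2) :=
        ((((hboxc i).comp (hgraph u)).pow 2).measurable.ennreal_ofReal).const_mul _
      rw [← lintegral_add_left hm]
      exact lintegral_mono fun y ↦ hgpt i u y
    have h5 : ∫⁻ u in Set.Ioi 0, ((∫⁻ y, ENNReal.ofReal (1 / 2) *
            ENNReal.ofReal (box i (E4.ofTimeSpace (u + F y) y) ^ 2)) +
          ∫⁻ y, ENNReal.ofReal (2 + L i) *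
            {y : E3 | Kerr.radius a (E4.ofTimeSpace (u + F y) y) ∉ Set.Ioo (lo i) (hi i)}.indicator
              (fun y ↦ ENNReal.ofReal (p2 i (E4.ofTimeSpace (u + F y) y))) y) =
        ENNReal.ofReal (1 / 2) * I5 + ENNReal.ofReal (2 + L i) * I4 := by
      rw [lintegral_add_left (hmeas_box i), hI5, hI4]
      congr 1
      · rw [← lintegral_const_mul' _ _ ENNReal.ofReal_ne_top]
        exact lintegral_congr fun u ↦ lintegral_const_mul' _ _ ENNReal.ofReal_ne_top
      · rw [← lintegral_const_mul' _ _ ENNReal.ofReal_ne_top]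
        exact lintegral_congr fun u ↦ lintegral_const_mul' _ _ ENNReal.ofReal_ne_top
    have h6 : I5 ≤ B * E0 := hP5 i
    have h7 : I4 ≤ B * E0 := hP4 i
    calc ENNReal.ofReal (∫ u in Set.Ioc τ' t, ∫ y, g i (E4.ofTimeSpace (u + F y) y))
        ≤ _ := h1.trans (h2.trans (h3.trans h4))
      _ = ENNReal.ofReal (1 / 2) * I5 + ENNReal.ofReal (2 + L i) * I4 := h5
      _ ≤ ENNReal.ofReal (1 / 2) * (B * E0) + ENNReal.ofReal (2 + L i) * (B * E0) :=
          add_le_add (mul_le_mul' le_rfl h6) (mul_le_mul' le_rfl h7)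
      _ = Kc i * B * E0 := by simp only [hKc]; ring
  -- ### the energy of each piece is bounded (late-time smallness + the estimate of `V_i`)
  have hpiece : ∀ i (τ' : ℝ), 0 ≤ τ' → Λ i τ' ≤ K i * B * E0 := by
    intro i τ' hτ'
    have key : ∀ t : ℝ, τ' < t → ENNReal.ofReal (b i) * Λ i τ' ≤
        ENNReal.ofReal (Cc i) * Λ i t + ENNReal.ofReal (Cc i) * (Kc i * B * E0) := by
      intro t ht
      have hR := hest i F hF2 hFc (w i) (hw i) (hsupp i) τ' (t - τ') (by linarith)
      have hts : τ' + (t - τ') = t := by ring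
      simp only [hts] at hR
      have hI0 : 0 ≤ ∫ u in Set.Ioc τ' t, ∫ y, g i (E4.ofTimeSpace (u + F y) y) :=
        integral_nonneg fun u ↦ integral_nonneg fun y ↦ hgnn i _
      have hE0' : 0 ≤ ∫ y, p2 i (E4.ofTimeSpace (t + F y) y) := integral_nonneg fun y ↦ hp2nn i _
      calc ENNReal.ofReal (b i) * Λ i τ'
          = ENNReal.ofReal (b i * ∫ y, p2 i (E4.ofTimeSpace (τ' + F y) y)) := by
            rw [ENNReal.ofReal_mul (hb i).le, hΛeq]
        _ ≤ ENNReal.ofReal (Cc i * (∫ y, p2 i (E4.ofTimeSpace (t + F y) y)) +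
              Cc i * ∫ u in Set.Ioc τ' t, ∫ y, g i (E4.ofTimeSpace (u + F y) y)) :=
            ENNReal.ofReal_le_ofReal hR
        _ ≤ ENNReal.ofReal (Cc i * ∫ y, p2 i (E4.ofTimeSpace (t + F y) y)) +
              ENNReal.ofReal (Cc i * ∫ u in Set.Ioc τ' t, ∫ y, g i (E4.ofTimeSpace (u + F y) y)) :=
            ENNReal.ofReal_add_le
        _ = ENNReal.ofReal (Cc i) * Λ i t + ENNReal.ofReal (Cc i) *
              ENNReal.ofReal (∫ u in Set.Ioc τ' t, ∫ y, g i (E4.ofTimeSpace (u + F y) y)) := by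
            rw [ENNReal.ofReal_mul (hCc i), ENNReal.ofReal_mul (hCc i), hΛeq]
        _ ≤ ENNReal.ofReal (Cc i) * Λ i t + ENNReal.ofReal (Cc i) * (Kc i * B * E0) :=
            add_le_add le_rfl (mul_le_mul' le_rfl (herrI i τ' t hτ'))
    -- late-time smallness
    have hsmall : ENNReal.ofReal (b i) * Λ i τ' ≤ ENNReal.ofReal (Cc i) * (Kc i * B * E0) := by
      refine ENNReal.le_of_forall_pos_le_add fun ε hε _ ↦ ?_
      set D : ℝ≥0∞ := ENNReal.ofReal (Cc i) + 1 with hD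
      have hD0 : D ≠ 0 := by rw [hD]; exact (lt_of_lt_of_le zero_lt_one le_add_self).ne'
      have hDtop : D ≠ ⊤ := by rw [hD]; exact ENNReal.add_ne_top.mpr ⟨ENNReal.ofReal_ne_top, ENNReal.one_ne_top⟩
      have hη : 0 < (ε : ℝ≥0∞) / D := ENNReal.div_pos (by exact_mod_cast hε.ne') hDtop
      obtain ⟨t, ht, hΛt⟩ := Kerr.exists_gt_le_of_lintegral_Ioi_lt_top (hP3 i) hη hτ'
      have h1 := key t ht
      have h2 : ENNReal.ofReal (Cc i) * Λ i t ≤ (ε : ℝ≥0∞) := by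
        calc ENNReal.ofReal (Cc i) * Λ i t ≤ D * ((ε : ℝ≥0∞) / D) :=
            mul_le_mul' (le_self_add) hΛt
          _ = ε := ENNReal.mul_div_cancel hD0 hDtop
      calc ENNReal.ofReal (b i) * Λ i τ' ≤ _ := h1
        _ ≤ (ε : ℝ≥0∞) + ENNReal.ofReal (Cc i) * (Kc i * B * E0) := add_le_add h2 le_rfl
        _ = ENNReal.ofReal (Cc i) * (Kc i * B * E0) + ε := add_comm _ _
    have hb0 : ENNReal.ofReal (b i) ≠ 0 := (ENNReal.ofReal_pos.mpr (hb i)).ne'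
    have hdiv : Λ i τ' ≤ ENNReal.ofReal (Cc i) * (Kc i * B * E0) / ENNReal.ofReal (b i) := by
      rw [ENNReal.le_div_iff_mul_le (Or.inl hb0) (Or.inl ENNReal.ofReal_ne_top), mul_comm]
      exact hsmall
    calc Λ i τ' ≤ _ := hdiv
      _ = K i * B * E0 := by
          simp only [hK, div_eq_mul_inv]
          ring
  -- ### the energy of `ψ` on the middle region
  set S : Set E3 := {y | A₀' < Kerr.radius a (E4.ofTimeSpace (τ + F y) y) ∧
    Kerr.radius a (E4.ofTimeSpace (τ + F y) y) < A₁'} with hSdef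
  have hS : MeasurableSet S := by
    have hrc : Continuous fun y : E3 ↦ Kerr.radius a (E4.ofTimeSpace (τ + F y) y) :=
      (Kerr.continuous_radius a).comp (hgraph τ)
    rw [hSdef, Set.setOf_and]
    exact ((isOpen_lt continuous_const hrc).inter (isOpen_lt hrc continuous_const)).measurableSet
  rcases hτ.eq_or_lt with hτ0 | hτpos
  · -- `τ = 0`: the trivial bound `E(0; S) ≤ E(0) ≤ C E(0)` (`C ≥ 1`)
    rw [← hτ0] at hSdef ⊢
    calc graphSliceEnergyOn (Kerr.exterior M a) ψ' F 0 S ≤ E0 := graphSliceEnergyOn_le _ _ _ _ _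
      _ = 1 * E0 := (one_mul _).symm
      _ ≤ Ctot * E0 := mul_le_mul' le_add_self le_rfl
  · -- `τ > 0`: on the leaf the solution is the sum of the pieces
    set Φ' : E4 → ℝ := Function.extend Subtype.val ψ' 0 with hΦ'
    set O : Set E4 := {x | x ∈ (Kerr.exterior M a : Set E4) ∧ A₀' < Kerr.radius a x ∧
      Kerr.radius a x < A₁' ∧ F (E4.spatial x) < x 0} with hO
    have hOopen : IsOpen O := by
      rw [hO, Set.setOf_and, Set.setOf_and, Set.setOf_and]
      refine (Kerr.exterior M a).isOpen.inter ((isOpen_lt continuous_const (Kerr.continuous_radius a)).inter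
        ((isOpen_lt (Kerr.continuous_radius a) continuous_const).inter ?_))
      exact isOpen_lt (hF2.continuous.comp E4.spatial.continuous) (E4.dx 0).continuous
    have hOeq : ∀ x ∈ O, Φ' x = ∑ i, w i x := by
      intro x hx
      have h := hP1 ⟨x, hx.1⟩ hx.2.1 hx.2.2.1 hx.2.2.2
      rw [hΦ', ← extend_rep ψ' ⟨x, hx.1⟩]
      exact h.symm
    have hfd : ∀ z ∈ O, fderiv ℝ Φ' z = ∑ i, fderiv ℝ (w i) z := by
      intro z hz
      have hev : Φ' =ᶠ[𝓝 z] fun x ↦ ∑ i, w i x := Filter.eventually_of_mem (hOopen.mem_nhds hz) hOeq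
      rw [hev.fderiv_eq]
      exact fderiv_fun_sum fun i _ ↦ ((hw i).differentiable two_ne_zero) z
    -- pointwise bound on the middle set
    have hpt : ∀ y ∈ S, {y : E3 | E4.ofTimeSpace (τ + F y) y ∈ Kerr.exterior M a}.indicator
        (fun y ↦ ENNReal.ofReal (coordEnergyDensity (Kerr.exterior M a) ψ' (E4.ofTimeSpace (τ + F y) y))) y ≤
        (m : ℝ≥0∞) * ∑ i, ENNReal.ofReal (p2 i (E4.ofTimeSpace (τ + F y) y)) := by
      intro y hy
      set z := E4.ofTimeSpace (τ + F y) y with hz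
      by_cases hzU : y ∈ {y : E3 | E4.ofTimeSpace (τ + F y) y ∈ Kerr.exterior M a}
      · rw [Set.indicator_of_mem hzU]
        have hzext : z ∈ (Kerr.exterior M a : Set E4) := hzU
        have hzO : z ∈ O := by
          refine ⟨hzext, hy.1, hy.2, ?_⟩
          simp only [hz, E4.spatial_ofTimeSpace, E4.ofTimeSpace_apply_zero]
          linarith
        rw [← Kerr.sum_sq_fderiv_extend_eq, hfd z hzO]
        have h1 : ∀ μ, ((∑ i, fderiv ℝ (w i) z) (E4.basisVector μ)) ^ 2 ≤
            (m : ℝ) * ∑ i, (fderiv ℝ (w i) z (E4.basisVector μ)) ^ 2 := by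
          intro μ
          have h := sq_sum_le_card_mul_sum_sq (s := (Finset.univ : Finset (Fin m)))
            (f := fun i ↦ fderiv ℝ (w i) z (E4.basisVector μ))
          simp only [Finset.card_univ, Fintype.card_fin] at h
          rw [FunLike.coe_sum, Finset.sum_apply]
          exact h
        have hcs : ∑ μ, ((∑ i, fderiv ℝ (w i) z) (E4.basisVector μ)) ^ 2 ≤ (m : ℝ) * ∑ i, p2 i z := by
          calc ∑ μ, ((∑ i, fderiv ℝ (w i) z) (E4.basisVector μ)) ^ 2
              ≤ ∑ μ, (m : ℝ) * ∑ i, (fderiv ℝ (w i) z (E4.basisVector μ)) ^ 2 :=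
                Finset.sum_le_sum fun μ _ ↦ h1 μ
            _ = (m : ℝ) * ∑ i, p2 i z := by
                rw [← Finset.mul_sum, Finset.sum_comm]
        calc ENNReal.ofReal (∑ μ, ((∑ i, fderiv ℝ (w i) z) (E4.basisVector μ)) ^ 2)
            ≤ ENNReal.ofReal ((m : ℝ) * ∑ i, p2 i z) := ENNReal.ofReal_le_ofReal hcs
          _ = (m : ℝ≥0∞) * ∑ i, ENNReal.ofReal (p2 i z) := by
              rw [ENNReal.ofReal_mul (Nat.cast_nonneg m), ENNReal.ofReal_natCast,
                ENNReal.ofReal_sum_of_nonneg (fun i _ ↦ hp2nn i z)]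
      · rw [Set.indicator_of_notMem hzU]
        exact zero_le
    -- integrate
    have hmeas : ∀ i, Measurable fun y : E3 ↦ ENNReal.ofReal (p2 i (E4.ofTimeSpace (τ + F y) y)) :=
      fun i ↦ ((hp2c i).comp (hgraph τ)).measurable.ennreal_ofReal
    calc graphSliceEnergyOn (Kerr.exterior M a) ψ' F τ S
        = ∫⁻ y in S, {y : E3 | E4.ofTimeSpace (τ + F y) y ∈ Kerr.exterior M a}.indicator
            (fun y ↦ ENNReal.ofReal
              (coordEnergyDensity (Kerr.exterior M a) ψ' (E4.ofTimeSpace (τ + F y) y))) y := rfl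
      _ ≤ ∫⁻ y in S, (m : ℝ≥0∞) * ∑ i, ENNReal.ofReal (p2 i (E4.ofTimeSpace (τ + F y) y)) :=
          setLIntegral_mono' hS hpt
      _ ≤ ∫⁻ y, (m : ℝ≥0∞) * ∑ i, ENNReal.ofReal (p2 i (E4.ofTimeSpace (τ + F y) y)) :=
          setLIntegral_le_lintegral _ _
      _ = (m : ℝ≥0∞) * ∑ i, Λ i τ := by
          rw [lintegral_const_mul' _ _ (ENNReal.natCast_ne_top m),
            lintegral_finsetSum _ (fun i _ ↦ hmeas i)]
      _ ≤ (m : ℝ≥0∞) * ∑ i, K i * B * E0 :=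
          mul_le_mul' le_rfl (Finset.sum_le_sum fun i _ ↦ hpiece i τ hτ)
      _ = (m : ℝ≥0∞) * (∑ i, K i) * B * E0 := by
          rw [Finset.mul_sum, Finset.mul_sum, Finset.sum_mul, Finset.sum_mul]
          exact Finset.sum_congr rfl fun i _ ↦ by ring
      _ ≤ Ctot * E0 := by
          rw [hCtot, add_mul, one_mul]
          exact le_self_add

end Literature.Geometry.Lorentzian
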